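import Mathlib.Analysis.Calculus.Deriv.Mul
import Mathlib.Analysis.Calculus.Deriv.Add
import Mathlib.Analysis.Calculus.Deriv.Slope
import Mathlib.Analysis.Complex.Basic

/-!
# Weak derivatives of a family of linear maps from eigen-data on a spanning set

Topic `Analysis/Calculus`.  A one-parameter family `ρ : 𝕜 → (V →ₗ[𝕜'] W)` of linear maps (parameter field
`𝕜`, scalar field `𝕜'` a normed `𝕜`-algebra — the motivating case is `𝕜 = ℝ`, `𝕜' = ℂ`: a real
one-parameter group acting on a complex vector space) is usually differentiated *weakly*: one asks for the
derivative of `s ↦ Λ (ρ s v)` for linear observations `Λ` into a normed space, or — with no norm on the target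
at all — for the limit of the difference quotients `(s - x)⁻¹ • (ρ s v - ρ x v)` in a topological vector space.

The four lemmas of this file are the standard bookkeeping behind "differentiate the action of a torus on a
space spanned by weight vectors":

* `hasDerivAt_apply_of_eigen` — if `ρ s v = c s • v` with `HasDerivAt c c' x`, then `s ↦ Λ (ρ s v)` has
  derivative `c' • Λ v` at `x`;
* `hasDerivAt_apply_of_span` — the weak statement `HasDerivAt (s ↦ Λ (ρ s φ)) (Λ (D φ)) x` for a linear
  candidate derivative `D` is closed under linear combinations in `φ`, hence passes from a spanning set to
  every vector;
* `tendsto_slope_of_eigen`, `tendsto_slope_of_span` — the same two statements for bare difference quotients in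
  a topological vector space (no norm, no observation).

All four are [folklore] (linearity of the derivative; e.g. the computation of the differential of a
finite-dimensional representation of a torus on its weight vectors).  Everything is proved, Mathlib only.

## Provenance

Reproduced for the tree under the LEAN-IN-TREE rule (2026-08-18) from the pub-hodgecm cell's package file
`HodgeCM/PerL34/FockTorusOrbitDeriv.lean` §1 (DAG-node prover #12 lineage, seat pv12-g9, gate run 31 staging),
generalised from (`ℝ`, `ℂ`, base point `0`) to (`𝕜`, `𝕜'`, base point `x`); the hypothesis `c 0 = 1` of the
package's slope lemma is not needed and has been dropped.
-/

set_option autoImplicit false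

open Filter
open scoped _root_.Topology

namespace Literature.Analysis.Calculus

namespace LinearFamily

section Normed

variable {𝕜 : Type*} [NontriviallyNormedField 𝕜]
variable {𝕜' : Type*} [NontriviallyNormedField 𝕜'] [NormedAlgebra 𝕜 𝕜']
variable {V : Type*} [AddCommGroup V] [Module 𝕜' V]
variable {W : Type*} [AddCommGroup W] [Module 𝕜' W]
variable {E : Type*} [NormedAddCommGroup E] [NormedSpace 𝕜 E] [NormedSpace 𝕜' E] [IsScalarTower 𝕜 𝕜' E]

/-- **Eigen-data differentiate weakly.**  If every `ρ s` acts on `v` by the scalar `c s` (against a fixed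
vector `w`: `ρ s v = c s • w`) and `c` has derivative `c'` at `x`, then for every `𝕜'`-linear observation `Λ`
into a normed space the function `s ↦ Λ (ρ s v)` has derivative `c' • Λ w` at `x`. [folklore] -/
theorem hasDerivAt_apply_of_eigen (ρ : 𝕜 → V →ₗ[𝕜'] W) {v : V} {w : W} {c : 𝕜 → 𝕜'} {c' : 𝕜'} {x : 𝕜}
    (hv : ∀ s, ρ s v = c s • w) (hc : HasDerivAt c c' x) (Λ : W →ₗ[𝕜'] E) :
    HasDerivAt (fun s => Λ (ρ s v)) (c' • Λ w) x := by
  have h : (fun s => Λ (ρ s v)) = fun s => c s • Λ w := by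
    funext s
    rw [hv, map_smul]
  rw [h]
  exact hc.smul_const (Λ w)

/-- **Linear extension from a spanning set (normed form).**  For a family of linear maps `ρ s : V → W`, a
linear candidate derivative `D : V → W` and a linear observation `Λ : W → E`, the weak derivative statement
`HasDerivAt (s ↦ Λ (ρ s φ)) (Λ (D φ)) x` is closed under linear combinations in `φ`; so if it holds on a set
`S` spanning `V` it holds for every `φ : V`. [folklore] -/
theorem hasDerivAt_apply_of_span (ρ : 𝕜 → V →ₗ[𝕜'] W) (D : V →ₗ[𝕜'] W) (Λ : W →ₗ[𝕜'] E) {S : Set V}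
    (hS : Submodule.span 𝕜' S = ⊤) {x : 𝕜}
    (h : ∀ v ∈ S, HasDerivAt (fun s => Λ (ρ s v)) (Λ (D v)) x) (φ : V) :
    HasDerivAt (fun s => Λ (ρ s φ)) (Λ (D φ)) x := by
  have hφ : φ ∈ Submodule.span 𝕜' S := by
    rw [hS]
    exact Submodule.mem_top
  induction hφ using Submodule.span_induction with
  | mem v hv => exact h v hv
  | zero => simpa using hasDerivAt_const x (0 : E)
  | add u w _ _ hu hw => simpa [map_add, Pi.add_def] using hu.add hw
  | smul a u _ hu => simpa [map_smul, Pi.smul_def] using hu.const_smul a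

/-- The eigen-data form of `hasDerivAt_apply_of_span`: if `S` spans `V` and every `v ∈ S` is moved by the
family through differentiable scalars, `ρ s v = c v s • v` with `HasDerivAt (c v) (c' v) x`, and `D` is a
linear map with `D v = c' v • v` on `S`, then `s ↦ Λ (ρ s φ)` has derivative `Λ (D φ)` at `x` for every `φ`.
[folklore] -/
theorem hasDerivAt_apply_of_span_of_eigen (ρ : 𝕜 → V →ₗ[𝕜'] V) (D : V →ₗ[𝕜'] V) (Λ : V →ₗ[𝕜'] E)
    {S : Set V} (hS : Submodule.span 𝕜' S = ⊤) {x : 𝕜} {c : V → 𝕜 → 𝕜'} {c' : V → 𝕜'}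
    (hv : ∀ v ∈ S, ∀ s, ρ s v = c v s • v) (hc : ∀ v ∈ S, HasDerivAt (c v) (c' v) x)
    (hD : ∀ v ∈ S, D v = c' v • v) (φ : V) :
    HasDerivAt (fun s => Λ (ρ s φ)) (Λ (D φ)) x := by
  refine hasDerivAt_apply_of_span ρ D Λ hS (fun v hvS => ?_) φ
  rw [hD v hvS, map_smul]
  exact hasDerivAt_apply_of_eigen ρ (hv v hvS) (hc v hvS) Λ

end Normed

section TVS

variable {𝕜 : Type*} [NontriviallyNormedField 𝕜]
variable {𝕜' : Type*} [NontriviallyNormedField 𝕜'] [NormedAlgebra 𝕜 𝕜']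
variable {V : Type*} [AddCommGroup V] [Module 𝕜' V]
variable {W : Type*} [AddCommGroup W] [Module 𝕜' W] [Module 𝕜 W] [IsScalarTower 𝕜 𝕜' W]
  [TopologicalSpace W]

/-- **Eigen-data differentiate weakly (TVS form).**  No norm and no observation: for linear maps
`ρ s : V → W` into a topological `𝕜'`-vector space with `ρ s v = c s • w` and `HasDerivAt c c' x`, the
difference quotients `(s - x)⁻¹ • (ρ s v - ρ x v)` tend to `c' • w` along `𝓝[≠] x`. [folklore] -/
theorem tendsto_slope_of_eigen [ContinuousSMul 𝕜' W] (ρ : 𝕜 → V →ₗ[𝕜'] W) {v : V} {w : W}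
    {c : 𝕜 → 𝕜'} {c' : 𝕜'} {x : 𝕜} (hv : ∀ s, ρ s v = c s • w) (hc : HasDerivAt c c' x) :
    Tendsto (fun s => (s - x)⁻¹ • (ρ s v - ρ x v)) (𝓝[≠] x) (𝓝 (c' • w)) := by
  have h1 : Tendsto (fun s => (s - x)⁻¹ • (c s - c x)) (𝓝[≠] x) (𝓝 c') := hc.tendsto_slope
  have h2 : (fun s => (s - x)⁻¹ • (ρ s v - ρ x v)) = fun s => ((s - x)⁻¹ • (c s - c x)) • w := by
    funext s
    rw [hv, hv, ← sub_smul, smul_assoc]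
  rw [h2]
  exact h1.smul_const w

/-- **Linear extension from a spanning set (TVS form).**  The statement "the difference quotients of
`s ↦ ρ s φ` at `x` tend to `D φ`" is closed under linear combinations in `φ`, hence passes from a spanning
set `S` of `V` to every `φ : V`. [folklore] -/
theorem tendsto_slope_of_span [IsTopologicalAddGroup W] [ContinuousConstSMul 𝕜' W] (ρ : 𝕜 → V →ₗ[𝕜'] W)
    (D : V →ₗ[𝕜'] W) {S : Set V} (hS : Submodule.span 𝕜' S = ⊤) {x : 𝕜}
    (h : ∀ v ∈ S, Tendsto (fun s => (s - x)⁻¹ • (ρ s v - ρ x v)) (𝓝[≠] x) (𝓝 (D v))) (φ : V) :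
    Tendsto (fun s => (s - x)⁻¹ • (ρ s φ - ρ x φ)) (𝓝[≠] x) (𝓝 (D φ)) := by
  have hφ : φ ∈ Submodule.span 𝕜' S := by
    rw [hS]
    exact Submodule.mem_top
  induction hφ using Submodule.span_induction with
  | mem v hv => exact h v hv
  | zero => simpa using tendsto_const_nhds
  | add u w _ _ hu hw =>
      have e : (fun s => (s - x)⁻¹ • (ρ s (u + w) - ρ x (u + w))) =
          fun s => (s - x)⁻¹ • (ρ s u - ρ x u) + (s - x)⁻¹ • (ρ s w - ρ x w) := by
        funext s
        rw [map_add, map_add, ← smul_add]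
        congr 1
        abel
      rw [e, map_add]
      exact hu.add hw
  | smul a u _ hu =>
      have e : (fun s => (s - x)⁻¹ • (ρ s (a • u) - ρ x (a • u))) =
          fun s => a • ((s - x)⁻¹ • (ρ s u - ρ x u)) := by
        funext s
        rw [map_smul, map_smul, ← smul_sub, smul_comm]
      rw [e, map_smul]
      exact hu.const_smul a

/-- The eigen-data form of `tendsto_slope_of_span`. [folklore] -/
theorem tendsto_slope_of_span_of_eigen [IsTopologicalAddGroup W] [ContinuousSMul 𝕜' W]
    (ρ : 𝕜 → V →ₗ[𝕜'] W) (ι : V →ₗ[𝕜'] W) (D : V →ₗ[𝕜'] W) {S : Set V} (hS : Submodule.span 𝕜' S = ⊤)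
    {x : 𝕜} {c : V → 𝕜 → 𝕜'} {c' : V → 𝕜'}
    (hv : ∀ v ∈ S, ∀ s, ρ s v = c v s • ι v) (hc : ∀ v ∈ S, HasDerivAt (c v) (c' v) x)
    (hD : ∀ v ∈ S, D v = c' v • ι v) (φ : V) :
    Tendsto (fun s => (s - x)⁻¹ • (ρ s φ - ρ x φ)) (𝓝[≠] x) (𝓝 (D φ)) := by
  refine tendsto_slope_of_span ρ D hS (fun v hvS => ?_) φ
  rw [hD v hvS]
  exact tendsto_slope_of_eigen ρ (hv v hvS) (hc v hvS)

end TVS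

section RealComplex

/-! ### The motivating instance: real parameter, complex scalars

For `𝕜 = ℝ`, `𝕜' = ℂ` the instances `NormedAlgebra ℝ ℂ`, `NormedSpace ℝ E` / `Module ℝ W` (restriction of
scalars, `NormedSpace.complexToReal` / `Module.complexToReal`) and `IsScalarTower ℝ ℂ _` are found
automatically; the real difference quotient `(s - x)⁻¹ • y` is the complex one `((s - x : ℝ) : ℂ)⁻¹ • y`. -/

variable {W : Type*} [AddCommGroup W] [Module ℂ W]

/-- In a complex vector space the real scalar action of `r⁻¹` is the complex action of `(↑r)⁻¹`. [folklore] -/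
theorem real_inv_smul_eq_coe_inv_smul (r : ℝ) (y : W) : r⁻¹ • y = ((r : ℂ))⁻¹ • y := by
  rw [← Complex.ofReal_inv, Complex.coe_smul]

variable [TopologicalSpace W] [ContinuousSMul ℂ W] {V : Type*} [AddCommGroup V] [Module ℂ V]

/-- `tendsto_slope_of_eigen` at `x = 0` for a real family on complex spaces, with the difference quotient
written through the coercion `ℝ → ℂ` (the form used for one-parameter subgroups `s ↦ exp (s X)`). [folklore] -/
theorem tendsto_coe_inv_smul_of_eigen (ρ : ℝ → V →ₗ[ℂ] W) {v : V} {w : W} {c : ℝ → ℂ} {c' : ℂ}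
    (hv : ∀ s, ρ s v = c s • w) (hc : HasDerivAt c c' 0) :
    Tendsto (fun s : ℝ => ((s : ℂ))⁻¹ • (ρ s v - ρ 0 v)) (𝓝[≠] 0) (𝓝 (c' • w)) := by
  have h := tendsto_slope_of_eigen ρ hv hc
  simp only [sub_zero] at h
  refine h.congr fun s => ?_
  rw [real_inv_smul_eq_coe_inv_smul]

end RealComplex

end LinearFamily

end Literature.Analysis.Calculus
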